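import Literature.MathematicalPhysics.QuantumFieldTheory.Balaban1983to89.Node00.Record13CarriersSepCoPR

/-!
# BalabanUVNodes ∕ N10 — THE ₁₃ STOREY IN THE v1.6 (rev-22) VOCABULARY: N10's K1-facing ∃-faces «a `IsRecordOfRecord₁₃CSepCoPR` record of θ's OWN `datumOfRecord₁₃SepCoPR`
# with `Dag.B13_main` at every run» at the C-binding of the [B13]-pinned Stage-13 view OF THE v1.6 PARAMETERS `θ : Stage13RParams`, from the leaf ∕ the family leaf of record — the
# token-map twin of `…N10AtRecord13SepCoPB13` (p524119) under node00-def-T's v1.6 map T₆ (`CoP ↦ CoPR`, `θ : Stage13Params ↦ θ : Stage13RParams`, guard `ZtUnity ↦ ZrUnity`) over this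
# seat's carrier leaves `Node00/Record13CarriersCoPR` (§0 the R-level pins; §4 the [B13] face) and `Node00/Record13CarriersSepCoPR` (Track A, DAG node N10 [B13]; strategy s2; seat
# `pub-ymgap-dag-n10-d` g9; director-ym №169 H1 ∕ №174 PRESS WORD; count-neutral)

HONEST FRAMING.  Count-neutral kernel bookkeeping BY NAME over LANDED modules: node00-def-T g19's `Node00/Record13SepCoPR.lean` (p529780 ✓, RECORD 13 §11 over the v1.6 edition
`Record13CoPR` p529474 ✓ — the params layer `Stage13RParams` = `Stage13Params` + the RUN-INDEXED residual 𝐓-weight slot `Zr` (def-T LOCATED-8 «`Zt` is run-blind; print's ζ(Ω₁ᶜ) reads the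
run», ref-D ∕ ref-H (g1) REAL, director-ym №169 H1): `Stage13RParams.Provisos₁₃SepCoPR` — row P11 on print's SEPARATED (2.18) sequences, partition-compatible runs `PartCompat₁₃` AND
print's (7)-regular data, rows `hM ∕ hM₁`, `bg` at print's background, `zrLaws ∕ zrLocal` —, `datumOfRecord₁₃SepCoPR`, `IsRecordOfRecord₁₃CSepCoPR` over the view `toStage5₁₃CoPR`; the
K0-class guard `ZrUnity ∧ SlotsNondegenerate₁₃` (def-T Q1)), this seat's `Node00/Record13CarriersSepCoPR` (`Provisos₁₃SepCoPR.pinB13`, `datumOfRecord₁₃SepCoPR_pinB13 : rfl`,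
`isRecordOfRecord₁₃CSepCoPR_pinB13_of_eq`) and `Node00/Record13CarriersCoPR` (§0 `Stage13RParams.pinB13` := the R-level re-binding over def-B13's `XB13OfRecord`; §4
`b13_main_at_toStage5₁₃CoPR_pinB13` — the [B13] face at the v1.6 view, proviso-free).  §1 = p524119 §1 RE-KEYED: for any admissible v1.6 package `θ : Stage13RParams` with the v1.6
provisos `h : θ.Provisos₁₃SepCoPR F N` and any per-run [B13] layer carrying THE LEAF `B13LeafOfRecord θ₃ (lam13 P)` at every run, the world bound at the C-binding of
`(θ.pinB13 lam13).toStage5₁₃CoPR` is a v1.6 ₁₃C record of θ's OWN v1.6 datum with `Dag.B13_main` at every run (any window `γw ∈ ]0, θ.γ]`, block size `θ.L`); the family-currency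
form with a per-run member selection; the rung-1 ∃-shape restricted to N10's conjunct with the v1.6 guard `ZrUnity ∧ SlotsNondegenerate₁₃`.  §2 = p524119 §2 RE-KEYED (HONESTY, R433
species): the ∃-currency is junk-dischargeable through def-B13's zero term tower at EVERY such package — content enters only when `lam13` is the term tower OF RECORD (def-B13's storeys)
with the leaf from located inputs that are THEOREMS about that tower (dag-n10-c's lane).  (No bridge out of the v1.6 record to the `Zt`-keyed editions exists — director-ym №169 (1);
a v1.5-keyed user re-keys on `Provisos₁₃SepCoPR` by T₆.)  COMPOSITE as to the other nodes; nothing discharged; NOT the stub; nothing of Bałaban's asserted; N10 NOT discharged; no count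
moves (typed 28∕28 · discharged 5∕27); one finite four-torus programme at fixed ε per run; nothing continuum ∕ ℝ⁴ ∕ OS ∕ mass-gap ∕ Clay.  0 `sorry`, 0 `def`, standard axioms.  Filed
`--kind proof --supports` the K1 item of the day `--as helper` (K1⁵ stmt-QuantumFields-20294 until plan's rev-22 NEW-IDS ∕ dag-lead WORDS-142 name K1⁶).

WHAT THIS FILE PROVES.  §1 `exists_record₁₃CSepCoPR_pinB13World_b13_main_of_leafOfRecord`, `exists_record₁₃CSepCoPR_pinB13World_b13_main_of_famLeafOfRecord`,
`exists_guarded_record₁₃CSepCoPR_b13_main_of_leafOfRecord` (the rung-1 ∃-shape, N10's conjunct);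
§2 `exists_record₁₃CSepCoPR_world_b13_main_of_zeroTower`.
-/

namespace Summit.QuantumFields.YangMills.BalabanUVNodes.N10AtRecord13SepCoPRB13

open Literature.MathematicalPhysics.QuantumFieldTheory.Balaban1983to89
open Literature.MathematicalPhysics.QuantumFieldTheory.Balaban1983to89.T4Continuum
open Literature.MathematicalPhysics.QuantumFieldTheory.Balaban1983to89.DagBinding
open Literature.MathematicalPhysics.QuantumFieldTheory.Balaban1983to89.Node00
open scoped Matrix.Norms.L2Operator

/-! ## §1. The K1-facing ∃-faces: a v1.6 ₁₃C record of θ's OWN v1.6 datum with `Dag.B13_main` at every run -/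

section K1Facing

variable (F : T4Family) (N : ℕ) [NeZero N]

/-- **FOR ANY ADMISSIBLE v1.6 PACKAGE `θ : Stage13RParams` WITH THE v1.6 PROVISOS AND ANY PER-RUN [B13] LAYER CARRYING THE LEAF AT EVERY RUN, THE WORLD BOUND AT THE C-BINDING OF THE
[B13]-PINNED STAGE-13 VIEW IS A v1.6 ₁₃C RECORD OF θ's OWN v1.6 DATUM WITH `Dag.B13_main` AT EVERY RUN** (any window `γw ∈ ]0, θ.γ]`, block size `θ.L`; the pin is UP-SIDE,
`Record13CarriersSepCoPR.isRecordOfRecord₁₃CSepCoPR_pinB13_of_eq`).  N10's conjunct of the rev-22 K1-class item, modulo the leaf and the other nodes at the SAME world.  Count-neutral.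
[cite: Balaban1988RG2Cluster, Lemmas 1–3 pp.9, 11, 20; Balaban1989LargeFieldII, Thm 1 + (0.1) pp.355–356; Balaban1988Convergent, (2.18) p.257, (2.28) p.259 (the record, separated range)] -/
theorem exists_record₁₃CSepCoPR_pinB13World_b13_main_of_leafOfRecord (θ : Stage13RParams F N) (h : θ.Provisos₁₃SepCoPR F N) (hθ : θ.Admissible F N)
    (lam13 : B12.RunParams → ResidB13 θ.toStage3Params) {γw : ℝ} (hγw : 0 < γw ∧ γw ≤ θ.γ)
    (hleaf : ∀ P, B13LeafOfRecord θ.toStage3Params (lam13 P)) :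
    ∃ w : WorldP, IsRecordOfRecord₁₃CSepCoPR F N (datumOfRecord₁₃SepCoPR F N θ h) w ∧ w.γ = γw ∧ w.L = (θ.L : ℝ) ∧
      (∀ P, w.up P = upOfRecord₅C F N ((θ.pinB13 F N lam13).toStage5₁₃CoPR F N) P) ∧ ∀ P : B12.RunParams, Dag.B13_main (leavesP w P) := by
  obtain ⟨w₀⟩ := nonempty_worldP
  let w : WorldP :=
    { w₀ with
      C := (datumOfRecord₁₃SepCoPR F N θ h).C, γ := γw, L := (θ.L : ℝ), one_lt_L := by exact_mod_cast θ.hL.2,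
      up := fun P => upOfRecord₅C F N ((θ.pinB13 F N lam13).toStage5₁₃CoPR F N) P }
  exact ⟨w, isRecordOfRecord₁₃CSepCoPR_pinB13_of_eq F N θ h hθ lam13 w rfl hγw rfl (fun _ => rfl), rfl, rfl, fun _ => rfl,
    fun P => b13_main_at_toStage5₁₃CoPR_pinB13 θ lam13 w P rfl fun _ _ _ _ => hleaf P⟩

/-- **THE SAME IN THE FAMILY CURRENCY** (def-B13 g3's member bridge `b13LeafOfRecord_member₁₂` read at `θ.toStage12Params`): for any Stage-12∕13 [B13] family carrying the
family leaf of record at EVERY run and any per-run SELECTION of a box member with the letters of record (`κ P, ν P` displayed), the world bound at the C-binding of the view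
[B13]-PINNED AT THE SELECTED MEMBERS is a v1.6 ₁₃C record of θ's own v1.6 datum with `Dag.B13_main` at every run. [cite: Balaban1988RG2Cluster, Lemmas 1–3 pp.9, 11, 20; Balaban1987RG1, Thm 3 p.264; Balaban1989LargeFieldII, Thm 1 + (0.1) pp.355–356] -/
theorem exists_record₁₃CSepCoPR_pinB13World_b13_main_of_famLeafOfRecord (θ : Stage13RParams F N) (h : θ.Provisos₁₃SepCoPR F N) (hθ : θ.Admissible F N) {γw : ℝ}
    (hγw : 0 < γw ∧ γw ≤ θ.γ) (c : B13.Consts) (lamF : ResidB13Fam₁₂ F N θ.toStage12Params)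
    (hleaf : ∀ P, B13FamLeafOfRecord₁₂ F N θ.toStage12Params c lamF P) (κ : B12.RunParams → ℕ) (ν : (P : B12.RunParams) → Fin (κ P + 1) → ℝ)
    (hν : ∀ P, ν P ∈ FlowStep.Box θ.γ (κ P)) (hc : ∀ P, (lamF P (κ P) (ν P)).c = c13OfRecord₁₂ F N θ.toStage12Params c) :
    ∃ w : WorldP, IsRecordOfRecord₁₃CSepCoPR F N (datumOfRecord₁₃SepCoPR F N θ h) w ∧ w.γ = γw ∧ w.L = (θ.L : ℝ) ∧
      (∀ P, w.up P = upOfRecord₅C F N ((θ.pinB13 F N fun P => lamF P (κ P) (ν P)).toStage5₁₃CoPR F N) P) ∧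
        ∀ P : B12.RunParams, Dag.B13_main (leavesP w P) :=
  exists_record₁₃CSepCoPR_pinB13World_b13_main_of_leafOfRecord F N θ h hθ (fun P => lamF P (κ P) (ν P)) hγw
    fun P => b13LeafOfRecord_member₁₂ (hleaf P) (hν P) (hc P)

/-- **THE RUNG-1 SHAPE OF THE rev-22 K1 SKELETON (the `SepCoPR` token-swap of `K1Skeleton13SepCoP(v3)`'s `NodesAtSomeRecord13P(W)`, N10's conjunct only), WITNESSED BY `(θ, h, w)`
FOR EVERY ADMISSIBLE STAGE-13 PACKAGE WITH THE v1.6 PROVISOS AND THE GUARD, given the leaf at a per-run [B13] layer** — `∃ θ' h' w, (ZrUnity ∧ SlotsNondegenerate₁₃) ∧ Admissible ∧ IsRecordOfRecord₁₃CSepCoPR (datumOfRecord₁₃SepCoPR θ' h') w ∧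
∀ P, Dag.B13_main (leavesP w P)`.  N10 ALONE at its own world (the joint rung needs all thirteen nodes at ONE world: the pointed form above + dag-n24-c's engine at `θ.pinX3`).
NOT the stub; count-neutral. [cite: Balaban1988RG2Cluster, Lemmas 1–3 pp.9, 11, 20; Balaban1989LargeFieldII, Thm 1 + (0.1) pp.355–356; Balaban1988Convergent, (3.16)–(3.22) pp.268–269 (the guard; bookkeeping)] -/
theorem exists_guarded_record₁₃CSepCoPR_b13_main_of_leafOfRecord (θ : Stage13RParams F N) (h : θ.Provisos₁₃SepCoPR F N) (hU : θ.ZrUnity F N ∧ θ.SlotsNondegenerate₁₃ F N)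
    (hθ : θ.Admissible F N) (lam13 : B12.RunParams → ResidB13 θ.toStage3Params) (hleaf : ∀ P, B13LeafOfRecord θ.toStage3Params (lam13 P)) :
    ∃ (θ' : Stage13RParams F N) (h' : θ'.Provisos₁₃SepCoPR F N) (w : WorldP), (θ'.ZrUnity F N ∧ θ'.SlotsNondegenerate₁₃ F N) ∧ θ'.Admissible F N ∧
      IsRecordOfRecord₁₃CSepCoPR F N (datumOfRecord₁₃SepCoPR F N θ' h') w ∧ ∀ P : B12.RunParams, Dag.B13_main (leavesP w P) := by
  obtain ⟨w, hR, -, -, -, hN⟩ := exists_record₁₃CSepCoPR_pinB13World_b13_main_of_leafOfRecord F N θ h hθ lam13 ⟨hθ.toStage9.gamma_pos, le_rfl⟩ hleaf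
  exact ⟨θ, h, w, hU, hθ, hR, hN⟩

end K1Facing

/-! ## §2. HONESTY (R433 species): the v1.6 ∃-currency is junk-dischargeable through def-B13's zero tower at EVERY Stage-13 package, exactly as the v1.1 one -/

section Honesty

variable (F : T4Family) (N : ℕ) [NeZero N]

/-- **N10's CONJUNCT OF «NODES AT SOME v1.6 STAGE-13 RECORD» IS JUNK-DISCHARGEABLE IN THE ∃-CURRENCY, AT EVERY STAGE-13 PACKAGE WITH THE v1.6 PROVISOS** — §1 with `lam13 :=`
def-B13's ZERO TERM TOWER WITH FULL SPACES (`Node00.exists_residB13_b13LeafOfRecord_univ`).  The rev-22 re-key does not touch this reading: content enters only when `lam13` is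
PINNED to a term tower OF RECORD with the leaf supplied from located inputs that are THEOREMS about that tower.  Count-neutral. [cite: Balaban1988RG2Cluster, (1.33) p.9, (1.41)–(1.42) p.11, (2.9)–(2.14) pp.14–15, Lemmas 1–3 pp.9, 11, 20] -/
theorem exists_record₁₃CSepCoPR_world_b13_main_of_zeroTower (θ : Stage13RParams F N) (h : θ.Provisos₁₃SepCoPR F N) (hθ : θ.Admissible F N) {γw : ℝ}
    (hγw : 0 < γw ∧ γw ≤ θ.γ) :
    ∃ w : WorldP, IsRecordOfRecord₁₃CSepCoPR F N (datumOfRecord₁₃SepCoPR F N θ h) w ∧ w.γ = γw ∧ w.L = (θ.L : ℝ) ∧ ∀ P : B12.RunParams, Dag.B13_main (leavesP w P) := by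
  obtain ⟨lam, -, -, -, hleaf⟩ := exists_residB13_b13LeafOfRecord_univ θ.toStage3Params
  obtain ⟨w, hR, hγ, hL, -, hN⟩ := exists_record₁₃CSepCoPR_pinB13World_b13_main_of_leafOfRecord F N θ h hθ (fun _ => lam) hγw fun _ => hleaf
  exact ⟨w, hR, hγ, hL, hN⟩

end Honesty

end Summit.QuantumFields.YangMills.BalabanUVNodes.N10AtRecord13SepCoPRB13
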